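/-
Copyright: statement-level skeleton of a published paper (lit-balaban cell, Phase-2 proof seat p25, gen 19). No proof
claims beyond what the kernel checks below.
-/
import Literature.MathematicalPhysics.QuantumFieldTheory.BalabanImbrieJaffe1984to88.BIJ88WalkBlockSupport312
import Literature.MathematicalPhysics.QuantumFieldTheory.BalabanImbrieJaffe1984to88.BIJ88Sect5StatementsPart4

/-!
# `BalabanImbrieJaffe1984to88.BIJ88WalkIneq312Blocks` — T. Bałaban, J. Imbrie, A. Jaffe, *Effective action and cluster
properties of the abelian Higgs model*, Commun. Math. Phys. **114** (1988) 257–315 [BalabanImbrieJaffe1988], §5.14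
p. 312 [PDF 56], verbatim: *"Summing all possible diagrams in X_c gives the observable for the next step there,
F_{k+1,loc}(X_c)."*, *"The main source of concern in estimating G_k(X_{r′}) is that we only have bounds
|F_{k,loc}(X_{σ₁})| ≤ c(L^kε)^{−m(c)}e^{−m′(c)} coming from our estimates on perturbation expansions of observables
similarly for F_{k+1,loc}(X_c)."*, *"These considerations lead to the following estimate:
|G_k(X)| ≤ c(F(X))(e^β(L^kε/ε₀)^{1/4−α})^{β′|X∖∪X_c|} Π [c(L^kε)^{−m(c)}e^{−m′(c)}]"* — **THE TYPED LEAF `Ineq312`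
INHABITED BY THE CONSTANT-BLOCK ACTIVITIES OF THE COVARIANCE-SPLIT EXPANSION** (p25 gen 19): r16's schematic leaf
`BIJ88Sect5StatementsPart4.Ineq312 Q Gk cF obsProd nfree θ β′` (*"|Gk X| ≤ cF X · θ^{β′·nfree X} · obsProd X"*) is
proved for the polymer system of LOCATED BLOCKS `(Q, X)` (a set of observables `Q` whose run ends constant, localized
at the cube set `X` — print's `F_{k+1,loc}(X_c)`, *"similarly"* bounded) with `Gk (Q,X) = flAt(min Q, Q∖min Q, X)`
(gen 18's `BIJ88WalkBlockActivity312.flAt`), `cF (Q,X) = W_Q^{Φ(Q)}` with `W_Q = max(1, ρ₀·(Φ(Q)+N₀))` (the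
combinatorial constant, print's `c(F(X))`), `obsProd (Q,X) = Π_{j∈Q} B_ℓ^{|obs j|}` (the large constant per
observable), `nfree (Q,X) = #(X ∖ ⋃_{j∈Q} oc j)` (*"|X∖∪X_c|"*), `β′ = 1` (`ineq312_blocks`); the activities vanish off
`R`-connected cube sets (`gk_blocks_eq_zero_of_not_isRConnected`).  The remainder families `X_r` — print's `G_k` proper —
are the sibling `BIJ88WalkIneq312Remainder`.

statement-level skeleton of published theorems with citation tags; proofs where landed; nothing here is a claim
about the Yang–Mills mass gap

PDF held: `paper:balaban1988-cmp114-bij-abelian-higgs-effective-action` (journal page = PDF page + 256); p. 312 =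
PDF 56 (`p0056.txt` L3–4, L20–22, L27–29 re-read this session, 2026-08-23).

CITATION HEADER (lean-in-tree rule).  lit-balaban cell (HOME `run/shared/lean/pub/lit-balaban/`), Phase 2, seat p25
gen 19; row **C2.Claim@312** of `HOME/lit-balaban-r16/ROWS-C2-part2.md` (owner r16, referee ref-5; head
`BIJ88Sect5StatementsPart4.Ineq312` INHABITED here for the block activities of the Walk lane — the head's status is the
owner's call).  USED BY NAME, nothing restated: `BIJ88Sect5StatementsPart4.Ineq312`, `BIJ88Sect5StatementsPart2.PolymerSys`
(r16), `BIJ88WalkBlockActivity312.{flAt, flAbsAt, abs_flAt_le, flAbsAt_le}`, `BIJ88WalkBlockSupport312.flAt_eq_zero_of_not_isRConnected`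
(p25 gen 18), `BIJ88VertexComponents311.maxArity`, `Literature.Probability.LatticeModels.IsRConnected`.

## What is proved (0 `sorry`, standard axioms, no new `Prop` facts; definitions with bodies: `blockSys`, `gkBlock`,
`phiBlock`)

* `blockSys` (located blocks `(Q, X)` as a `PolymerSys`, `|(Q,X)| = #X`), `gkBlock` (`flAt` from the least observable of
  `Q`; `0` for `Q = ∅`), `phiBlock` (`Φ(Q) = Σ_{j∈Q}|obs j| + 1 + M·maxArity`), `gk_blocks_eq_zero_of_not_isRConnected`,
  **`ineq312_blocks`**.
HONEST SCOPE: (a) CONSTANT blocks only, not print's `G_k(X_{r′})`; (b) `cF` is our `W_Q^{Φ(Q)}`, not print's `c(F(X))`;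
locality (`ρ₀`, `N₀`) and the currency (`B_ℓ`, `θ`) are hypotheses in abstract form as in gen 18; (c) contraction-graph
components; (d) the leaf `Ineq312` constrains only the SHAPE of the bound — the content is in the three explicit
functions.  NOT summit progress; NOT continuum; NOT Clay.  Imports `BIJ88WalkBlockSupport312`,
`BIJ88Sect5StatementsPart4`; modifies nothing.
-/

noncomputable section

namespace Literature.MathematicalPhysics.QuantumFieldTheory.BalabanImbrieJaffe1984to88.BIJ88WalkIneq312Blocks

open Classical Matrix Finset
open scoped BigOperators
open Literature.Probability.LatticeModels (IsRConnected)
open BIJ88VertexComponents311 (maxArity)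
open BIJ88WalkRun311 BIJ88WalkGeometry311 BIJ88WalkBlockActivity312 BIJ88WalkBlockSupport312

variable {S : Type} [Fintype S] {ι : Type} [Fintype ι] {κ : Type} [LinearOrder κ] {P : Type} [Fintype P]
  {β : Type} [DecidableEq β]

/-- **Located blocks as a polymer system**: a block is a set of observables `Q` localized at a cube set `X`; its size is
the number of cubes. [cite: BalabanImbrieJaffe1988, §5.14 p.312] -/
def blockSys (κ β : Type) : BIJ88Sect5StatementsPart2.PolymerSys := ⟨Finset κ × Finset β, fun QX => QX.2.card⟩

section Defs

variable (Cov : P → Matrix S S ℝ) (trig : P → Bool) (f : S → ℝ) (c : ι → ℝ) (legs : ι → List (S → ℝ))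
  (obs : κ → List (S → ℝ)) (M : ℕ) (oc : κ → Finset β) (vc : ι → Finset β) (reg : P → Finset β)

/-- **The activity of the located block `(Q, X)`**: the constant-component activity of the least observable of `Q`
run in the environment `Q ∖ min Q`, localized at `X` (`BIJ88WalkBlockActivity312.flAt`); no observable, no block.
[cite: BalabanImbrieJaffe1988, §5.14 p.312] -/
def gkBlock (QX : Finset κ × Finset β) : ℝ :=
  if h : QX.1.Nonempty then flAt Cov trig f c legs obs M oc vc reg (QX.1.min' h) (QX.1.erase (QX.1.min' h)) QX.2 else 0

/-- The leg potential of a block, `Φ(Q) = Σ_{j∈Q}|obs j| + 1 + M·maxArity` (the exponent of the combinatorial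
constant). [cite: BalabanImbrieJaffe1988, §5.14 p.312] -/
def phiBlock (Q : Finset κ) : ℕ := ∑ j ∈ Q, (obs j).length + 1 + M * maxArity legs

end Defs

variable {Cov : P → Matrix S S ℝ} {trig : P → Bool} {f : S → ℝ} {c : ι → ℝ} {legs : ι → List (S → ℝ)}
  {obs : κ → List (S → ℝ)} {M : ℕ} {oc : κ → Finset β} {vc : ι → Finset β} {reg : P → Finset β}

/-- **The block activities are supported on `R`-connected cube sets** (print: the `X_c` are connected components of
`X`), from `BIJ88WalkBlockSupport312.flAt_eq_zero_of_not_isRConnected`. [cite: BalabanImbrieJaffe1988, §5.14 p.311–312] -/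
theorem gk_blocks_eq_zero_of_not_isRConnected {R : β → β → Prop} {lc : (S → ℝ) → β}
    (hlink : ∀ p u w, (Cov p *ᵥ u) ⬝ᵥ w ≠ 0 → IsRConnected R (insert (lc u) (insert (lc w) (reg p))))
    (hhalf : ∀ p u, Cov p *ᵥ u ≠ 0 → IsRConnected R (insert (lc u) (reg p)))
    (hocc : ∀ j, IsRConnected R (oc j)) (hobs : ∀ j, ∀ w ∈ obs j, lc w ∈ oc j)
    (hvcc : ∀ m, IsRConnected R (vc m)) (hlegs : ∀ m, ∀ w ∈ legs m, lc w ∈ vc m)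
    {QX : Finset κ × Finset β} (hX : ¬ IsRConnected R QX.2) :
    gkBlock Cov trig f c legs obs M oc vc reg QX = 0 := by
  unfold gkBlock
  split_ifs with h
  · exact flAt_eq_zero_of_not_isRConnected hlink hhalf hocc hobs hvcc hlegs _ _ hX
  · rfl

/-- **THE TYPED LEAF `Ineq312` FOR THE LOCATED BLOCKS OF THE COVARIANCE-SPLIT EXPANSION**: under the hypotheses of
`BIJ88WalkBlockActivity312.flAbsAt_le` (observables and vertex legs with directions in `Dir`; brackets of the piece `p`
bounded by `B′_p·ρ_p`, `B′ ≤ B_ℓ` with no region on local pieces, `B′ ≤ θ^{#reg p}` on walk pieces, `B_ℓ ≥ 1`,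
`0 < θ ≤ 1`; `Σ_{p : C_p u ≠ 0} ρ p ≤ ρ₀`, `ρ₀ ≥ 0`; couplings `|c m| ≤ cV m`, `cV m·B_ℓ^{|legs m|} ≤ θ^{#vc m}`; at most
`N₀` vertex legs coupled to one `C_p u`; `ρ₀` of either sign — `W_Q ≥ 1` absorbs it):
`Ineq312 blockSys gkBlock (W_Q^{Φ(Q)}) (Π_{j∈Q} B_ℓ^{|obs j|}) (#(X ∖ ⋃_{j∈Q} oc j)) θ 1`, `W_Q = max(1, ρ₀·(Φ(Q)+N₀))`.
[cite: BalabanImbrieJaffe1988, (5.14.5) p.312] -/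
theorem ineq312_blocks {Dir : Set (S → ℝ)} {B' ρ : P → ℝ} {cV : ι → ℝ} {Bl θ ρ₀ : ℝ} {N₀ : ℕ}
    (hθ0 : 0 < θ) (hθ1 : θ ≤ 1) (hBl : 1 ≤ Bl) (hB0 : ∀ p, 0 ≤ B' p) (hρ : ∀ p, 0 ≤ ρ p) (hcV0 : ∀ m, 0 ≤ cV m)
    (hB : ∀ p, ∀ u ∈ Dir, ∀ w ∈ Dir, |(Cov p *ᵥ u) ⬝ᵥ w| ≤ B' p * ρ p)
    (hBf : ∀ p, ∀ u ∈ Dir, |(Cov p *ᵥ u) ⬝ᵥ f| ≤ B' p * ρ p) (hBz : ∀ p, ∀ u ∈ Dir, ‖Cov p *ᵥ u‖ ≤ B' p * ρ p)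
    (hcV : ∀ m, |c m| ≤ cV m) (hobs : ∀ j, ∀ w ∈ obs j, w ∈ Dir) (hlegs : ∀ m, ∀ w ∈ legs m, w ∈ Dir)
    (hloc : ∀ p, trig p = false → B' p ≤ Bl ∧ reg p = ∅) (hwalk : ∀ p, trig p = true → B' p ≤ θ ^ (reg p).card)
    (hvert : ∀ m, cV m * Bl ^ (legs m).length ≤ θ ^ (vc m).card)
    (hρ₀ : ∀ u ∈ Dir, (∑ p ∈ univ.filter (fun p => Cov p *ᵥ u ≠ 0), ρ p) ≤ ρ₀)
    (hN : ∀ p, ∀ u ∈ Dir,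
      (∑ m, ((range (legs m).length).filter fun j => (Cov p *ᵥ u) ⬝ᵥ (legs m).getD j 0 ≠ 0).card) ≤ N₀) :
    BIJ88Sect5StatementsPart4.Ineq312 (blockSys κ β) (gkBlock Cov trig f c legs obs M oc vc reg)
      (fun QX => (max 1 (ρ₀ * ((phiBlock legs obs M QX.1 + N₀ : ℕ) : ℝ))) ^ phiBlock legs obs M QX.1)
      (fun QX => ∏ j ∈ QX.1, Bl ^ (obs j).length)
      (fun QX => (QX.2 \ QX.1.biUnion oc).card) θ 1 := by
  intro QX
  obtain ⟨Q, X⟩ := QX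
  have hnf : θ ^ ((1 : ℝ) * ((X \ Q.biUnion oc).card : ℕ)) = θ ^ (X \ Q.biUnion oc).card := by
    rw [one_mul, Real.rpow_natCast]
  simp only []
  rw [hnf]
  by_cases hQ : Q.Nonempty
  swap
  · simp only [gkBlock, dif_neg hQ, abs_zero]
    exact mul_nonneg (mul_nonneg (pow_nonneg (le_max_left _ _ |> le_trans zero_le_one) _) (pow_nonneg hθ0.le _))
      (prod_nonneg fun j _ => pow_nonneg (zero_le_one.trans hBl) _)
  simp only [gkBlock, dif_pos hQ]
  have hi := Q.min'_mem hQ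
  have e : (obs (Q.min' hQ)).length + 1 + M * maxArity legs + ∑ j ∈ Q.erase (Q.min' hQ), (obs j).length
      = phiBlock legs obs M Q := by
    rw [phiBlock, ← Finset.add_sum_erase Q (fun j => (obs j).length) hi]
    ring
  set W := max 1 (ρ₀ * ((phiBlock legs obs M Q + N₀ : ℕ) : ℝ)) with hW
  have hW1 : 1 ≤ W := le_max_left _ _
  have hWb : ρ₀ * (((obs (Q.min' hQ)).length + 1 + M * maxArity legs + ∑ j ∈ Q.erase (Q.min' hQ), (obs j).length
      + N₀ : ℕ) : ℝ) ≤ W := by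
    rw [e]; exact le_max_right _ _
  have h := flAbsAt_le (trig := trig) (c := c) (oc := oc) (vc := vc) (reg := reg) hθ0 hθ1 hBl hB0 hρ hcV0 hB hBf hBz
    hcV hobs hlegs hloc hwalk hvert hρ₀ hN (i := Q.min' hQ) (B := Q.erase (Q.min' hQ)) (Finset.notMem_erase _ _) hW1 hWb X
  rw [e, Finset.insert_erase hi] at h
  calc |flAt Cov trig f c legs obs M oc vc reg (Q.min' hQ) (Q.erase (Q.min' hQ)) X|
      ≤ flAbsAt Cov trig f c legs obs M oc vc reg (Q.min' hQ) (Q.erase (Q.min' hQ)) X := abs_flAt_le _ _ _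
    _ ≤ W ^ phiBlock legs obs M Q * ((∏ j ∈ Q, Bl ^ (obs j).length) * θ ^ (X \ Q.biUnion oc).card) := h
    _ = _ := by ring

end Literature.MathematicalPhysics.QuantumFieldTheory.BalabanImbrieJaffe1984to88.BIJ88WalkIneq312Blocks

end
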